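import Summits.CriticalPhenomena.Ising3D.TaylorTableTheorem
import Summits.CriticalPhenomena.Ising3D.TaylorTableEvenEnclosures
import Summits.CriticalPhenomena.Ising3D.TaylorTableOddCoeffRec
import Mathlib.Tactic.Linarith
import Mathlib.Tactic.Positivity
import Mathlib.Tactic.Ring
import HarnessLib

/-!
# The TABLE layer of a derivative certificate, XII: every head and identity obligation AND every coefficient enclosure decided by the kernel
(cell `pub-ising3x`, seat boot-1 gen 6; gate (g2) — boot-1's share of the lead's G2-R trigger: after this file the
only named hypotheses of the table theorem are the two REGION layers)

HONEST FRAMING: lottery ticket; floor = tightest certified 3D Ising CFT bounds; no exact-solution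
claim without a proof. Island framing: certified exclusion region at stated derivative order and
assumptions; not a determination of the 3D Ising critical exponents beyond that.

* `oddHead_nonneg_of_kdCheck_reg'` — the regularised odd head cell with the enclosure hypothesis asked only for
  `b_ℓ < Δ` (what a table can certify: `regAB_mem`);
* `TaylorTable.EnclosuresStrict` and `boxExcluded_of_taylorTable_strict` (same data, same `T.check`);
* the DECIDABLE enclosure check `TaylorTable.checkEncl` — even cells by `evenEnclOK` (TaylorTableEvenEnclosures),
  odd cells by `oddEnclEntryOK`: the three families `cₛ = A(-t/2,t/2)`, `c₊ = A(t/2,t/2)`, `c₋ = A(-t/2,-t/2)`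
  (`t = Δσ - Δε ∈ [σlo - εhi, σhi - εlo]`) through the regularised interval recursion `regABI` on the boxes
  `(a, b, Δ) ∈ [a₁,a₂] × [b₁,b₂] × [lo,hi]`, divided by `λ_ℓ` (`legendreLamQ`) — with soundness
  `enclosuresStrict_of_checkEncl`;
* **`boxExcluded_of_taylorTable_dec : T.check = true → T.checkEncl = true → TaylorEvenRegion T.α T.box E₀ → T.OddCone
  → BoxExcluded T.box`.**
Sources: Kos–Poland–Simmons-Duffin 2014 §3.3 eq. (3.16); Dolan–Osborn 2004 §3; Hogervorst–Rychkov 2013 §3. Elementary.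
-/

namespace Summit.CriticalPhenomena.Ising3D

open Finset Set NonemptyInterval
open Literature.MathematicalPhysics.QuantumFieldTheory.ConformalBootstrap3D
open Literature.MathematicalPhysics.QuantumFieldTheory.ConformalBootstrap3D.PointKernel (legendreLamQ cast_legendreLamQ)
open Literature.Analysis.ValidatedNumerics

/-- **Odd head cell, regularised form, STRICT enclosure hypothesis**: as `oddHead_nonneg_of_kdCheck_reg` but the
per-term enclosures are only required for `b_ℓ < Δ` (at `Δ = b_ℓ` the regularised triple is not the limit value in
Lean's `x/0 = 0` convention, so a table cannot certify it there — and need not). [cite: KosPolandSimmonsduffin2014, §3.3 eq. (3.16)] -/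
theorem oddHead_nonneg_of_kdCheck_reg' (c : Fin 5 → ℕ × ℕ → ℚ) {L : List (ℕ × ℕ)} (hL : L.Nodup)
    (ψ : ℕ × ℕ → ℚ) {Lψ : List (ℕ × ℕ)} (hLψ : Lψ.Nodup) (κ₀ : ℚ) (ℓ : ℕ)
    {F : List (ℕ × ℕ)} (hF : F.Nodup) (hFj : ∀ q ∈ F, q.2 ≤ ℓ + q.1)
    {σlo σhi εlo εhi lo hi : ℚ} (hℓlo : (ℓ : ℚ) ≤ lo)
    {r₁ r₂ klo khi : ℚ} (hkhi : 0 < khi) (hr₁ : r₁ ≤ εlo - σhi) (hr₂ : εhi - σlo ≤ r₂)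
    (hk₁ : klo ^ r₂.den ≤ (1 / 2 : ℚ) ^ (r₂.num : ℤ)) (hk₂ : (1 / 2 : ℚ) ^ (r₁.num : ℤ) ≤ khi ^ r₁.den)
    {u₁ u₂ mσlo mσhi : ℚ} (hmσhi : 0 < mσhi) (hu₁ : u₁ ≤ -(2 * σhi)) (hu₂ : -(2 * σlo) ≤ u₂)
    (hmσ₁ : mσlo ^ u₂.den ≤ (1 / 2 : ℚ) ^ (u₂.num : ℤ)) (hmσ₂ : (1 / 2 : ℚ) ^ (u₁.num : ℤ) ≤ mσhi ^ u₁.den)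
    {v₁ v₂ mεlo mεhi : ℚ} (hmεhi : 0 < mεhi) (hv₁ : v₁ ≤ -(2 * εhi)) (hv₂ : -(2 * εlo) ≤ v₂)
    (hmε₁ : mεlo ^ v₂.den ≤ (1 / 2 : ℚ) ^ (v₂.num : ℤ)) (hmε₂ : (1 / 2 : ℚ) ^ (v₁.num : ℤ) ≤ mεhi ^ v₁.den)
    {A : List ((ℚ × ℚ) × (ℚ × ℚ) × (ℚ × ℚ))} (hA : A.length = F.length)
    (henc : ∀ p ∈ Icc (σlo : ℝ) σhi ×ˢ Icc (εlo : ℝ) εhi, ∀ Δ : ℝ, (lo : ℝ) ≤ Δ → Δ ≤ hi → unitarityBound3D ℓ < Δ →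
      ∀ (i : ℕ) (q : ℕ × ℕ) (I : (ℚ × ℚ) × (ℚ × ℚ) × (ℚ × ℚ)), F[i]? = some q → A[i]? = some I →
        ((I.1.1 : ℝ) ≤ (oddCoeffsReg p.1 p.2 Δ ℓ q).1 ∧ (oddCoeffsReg p.1 p.2 Δ ℓ q).1 ≤ (I.1.2 : ℝ)) ∧
        ((I.2.1.1 : ℝ) ≤ (oddCoeffsReg p.1 p.2 Δ ℓ q).2.1 ∧ (oddCoeffsReg p.1 p.2 Δ ℓ q).2.1 ≤ (I.2.1.2 : ℝ)) ∧
        ((I.2.2.1 : ℝ) ≤ (oddCoeffsReg p.1 p.2 Δ ℓ q).2.2 ∧ (oddCoeffsReg p.1 p.2 Δ ℓ q).2.2 ≤ (I.2.2.2 : ℝ)))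
    {t : KdCert ℕ}
    (ht : t.check (exprLeOn (.neg (oddBracketSumExpr c L ψ Lψ κ₀ ℓ F)) 0)
      (oddHeadBox σlo σhi εlo εhi lo hi klo khi mσlo mσhi mεlo mεhi A) = true) :
    ∀ p ∈ Icc (σlo : ℝ) σhi ×ˢ Icc (εlo : ℝ) εhi, ∀ Δ : ℝ, (lo : ℝ) ≤ Δ → Δ ≤ hi → unitarityBound3D ℓ < Δ →
      0 ≤ ∑ q ∈ F.toFinset, oddConeHeadValue (taylorCrossing (1 / 2) (1 / 2) L.toFinset (fun k ab => (c k ab : ℝ)))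
        (∑ ab ∈ Lψ.toFinset, (ψ ab : ℝ) • taylorCoeffAt (1 / 2) (1 / 2) ab) κ₀ p.1 p.2 Δ ℓ q := by
  intro p hp Δ hlo hhi hbΔ
  obtain ⟨⟨hσ1, hσ2⟩, ⟨hε1, hε2⟩⟩ := hp
  have hℓΔ : (ℓ : ℝ) ≤ Δ := by
    have : ((ℓ : ℚ) : ℝ) ≤ (lo : ℝ) := by exact_mod_cast hℓlo
    push_cast at this
    linarith
  have hr₁' : (r₁ : ℝ) ≤ (εlo : ℝ) - (σhi : ℝ) := by exact_mod_cast hr₁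
  have hr₂' : (εhi : ℝ) - (σlo : ℝ) ≤ (r₂ : ℝ) := by exact_mod_cast hr₂
  have hκ := half_rpow_mem_of_checks hkhi hk₁ hk₂ (t := p.2 - p.1) (by linarith) (by linarith)
  have hu₁' : (u₁ : ℝ) ≤ -(2 * (σhi : ℝ)) := by exact_mod_cast hu₁
  have hu₂' : -(2 * (σlo : ℝ)) ≤ (u₂ : ℝ) := by exact_mod_cast hu₂
  have hμσ := half_rpow_mem_of_checks hmσhi hmσ₁ hmσ₂ (t := -(2 * p.1)) (by linarith) (by linarith)
  have hv₁' : (v₁ : ℝ) ≤ -(2 * (εhi : ℝ)) := by exact_mod_cast hv₁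
  have hv₂' : -(2 * (εlo : ℝ)) ≤ (v₂ : ℝ) := by exact_mod_cast hv₂
  have hμε := half_rpow_mem_of_checks hmεhi hmε₁ hmε₂ (t := -(2 * p.2)) (by linarith) (by linarith)
  have hmem : (oddHeadBox σlo σhi εlo εhi lo hi klo khi mσlo mσhi mεlo mεhi A).mem
      (oddHeadPointReg ℓ F p.1 p.2 Δ) := by
    intro n
    match n with
    | 0 => exact ⟨hσ1, hσ2⟩
    | 1 => exact ⟨hε1, hε2⟩
    | 2 => exact ⟨hlo, hhi⟩
    | 3 => exact hκ
    | 4 => exact hμσ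
    | 5 => exact hμε
    | m + 6 =>
      simp only [oddHeadBox, Box.ivl, List.getD_cons_succ]
      by_cases hm : m < 3 * F.length
      · obtain ⟨i, r, hi, hr, rfl⟩ := exists_eq_three_mul_add _ _ hm
        obtain ⟨q, hq⟩ : ∃ q, F[i]? = some q := ⟨F[i], List.getElem?_eq_getElem hi⟩
        have hiA : i < A.length := hA ▸ hi
        have hI : A[i]? = some A[i] := List.getElem?_eq_getElem hiA
        obtain ⟨e1, e2, e3⟩ := henc p ⟨⟨hσ1, hσ2⟩, ⟨hε1, hε2⟩⟩ Δ hlo hhi hbΔ i q _ hq hI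
        obtain ⟨b1, b2, b3⟩ := getD_flat3 ((0 : ℚ), (0 : ℚ)) A i _ hI
        obtain ⟨v1, v2, v3⟩ := oddHeadPointReg_vars ℓ F p.1 p.2 Δ i q hq
        interval_cases r
        · rw [Nat.add_zero, b1, show 3 * i + 6 = 6 + 3 * i by ring, v1]; exact e1
        · rw [b2, show 3 * i + 1 + 6 = 6 + 3 * i + 1 by ring, v2]; exact e2
        · rw [b3, show 3 * i + 2 + 6 = 6 + 3 * i + 2 by ring, v3]; exact e3
      · rw [getD_flat3_of_le _ A m (by rw [hA]; omega)]
        simp only [oddHeadPointReg]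
        rw [getD_flat3_of_le _ _ m (by simpa using not_lt.mp hm)]
        simp
  have h := nonneg_of_kdCheck_neg ht _ hmem
  rw [eval_oddBracketSumExpr_reg c hL ψ hLψ κ₀ ℓ F] at h
  have hx : 0 < Δ - unitarityBound3D ℓ := sub_pos.mpr hbΔ
  have h' := (mul_nonneg_iff_of_pos_left hx).mp h
  have hFj' : ∀ q ∈ F.toFinset, (q.2 : ℝ) ≤ Δ + (q.1 : ℝ) := by
    intro q hq
    have h1 : q.2 ≤ ℓ + q.1 := hFj q (List.mem_toFinset.mp hq)
    have : (q.2 : ℝ) ≤ (ℓ : ℝ) + (q.1 : ℝ) := by exact_mod_cast h1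
    linarith
  rw [sum_oddConeHeadValue_half_nonneg_iff _ _ _ _ _ _ _ _ _ _ hFj', List.sum_toFinset _ hF]
  simpa [Real.rpow_natCast] using h'

namespace TaylorTable

variable (T : TaylorTable)

/-- HYPOTHESIS 1, strict regularised form: even enclosures as in `Enclosures`; odd enclosures of the regularised
triple `(Δ - b_ℓ)(cₛ, c₊, c₋)` on box × cell for `b_ℓ < Δ` only. [cite: KosPolandSimmonsduffin2014, §3.3 eq. (3.16)] -/
def EnclosuresStrict : Prop :=
  (∀ C ∈ T.evenCells, ∀ Δ : ℝ, (C.lo : ℝ) ≤ Δ → Δ ≤ C.hi → ∀ (i : ℕ) (q : ℕ × ℕ) (I : ℚ × ℚ),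
      C.F[i]? = some q → C.A[i]? = some I →
      (I.1 : ℝ) ≤ hrCoeff Δ C.ℓ q.1 q.2 / legendreLam C.ℓ ∧ hrCoeff Δ C.ℓ q.1 q.2 / legendreLam C.ℓ ≤ (I.2 : ℝ)) ∧
  (∀ C ∈ T.oddCells, ∀ p ∈ T.box, ∀ Δ : ℝ, (C.lo : ℝ) ≤ Δ → Δ ≤ C.hi → unitarityBound3D C.ℓ < Δ →
      ∀ (i : ℕ) (q : ℕ × ℕ) (I : (ℚ × ℚ) × (ℚ × ℚ) × (ℚ × ℚ)), C.F[i]? = some q → C.A[i]? = some I →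
        ((I.1.1 : ℝ) ≤ (oddCoeffsReg p.1 p.2 Δ C.ℓ q).1 ∧ (oddCoeffsReg p.1 p.2 Δ C.ℓ q).1 ≤ (I.1.2 : ℝ)) ∧
        ((I.2.1.1 : ℝ) ≤ (oddCoeffsReg p.1 p.2 Δ C.ℓ q).2.1 ∧ (oddCoeffsReg p.1 p.2 Δ C.ℓ q).2.1 ≤ (I.2.1.2 : ℝ)) ∧
        ((I.2.2.1 : ℝ) ≤ (oddCoeffsReg p.1 p.2 Δ C.ℓ q).2.2 ∧ (oddCoeffsReg p.1 p.2 Δ C.ℓ q).2.2 ≤ (I.2.2.2 : ℝ)))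

/-- **THE TABLE THEOREM (g2), strict regularised enclosures.** [cite: KosPolandSimmonsduffin2014, §3.3 eq. (3.16)] -/
theorem boxExcluded_of_taylorTable_strict (h : T.check = true) (hEnc : T.EnclosuresStrict)
    (hR : TaylorEvenRegion T.α T.box ((T.E₀ : ℚ) : ℝ)) (hC : T.OddCone) : BoxExcluded T.box := by
  -- unpack the Boolean
  simp only [check, Bool.and_eq_true] at h
  obtain ⟨⟨⟨⟨⟨hB, hI⟩, hEcells⟩, hEcov⟩, hOcells⟩, hOcov⟩ := h
  simp only [checkBasic, Bool.and_eq_true, decide_eq_true_eq] at hB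
  obtain ⟨⟨⟨⟨⟨⟨⟨⟨hL, hLψ⟩, hκ₀⟩, hσlo⟩, hσhi⟩, hgap⟩, hE₀⟩, hLE⟩, hLT⟩ := hB
  simp only [checkIdentity, Bool.and_eq_true, decide_eq_true_eq] at hI
  obtain ⟨⟨⟨⟨hκ, hμσ⟩, hμε⟩, hbI⟩, htI⟩ := hI
  obtain ⟨hκhi, hκr₁, hκr₂, hκ₁, hκ₂⟩ := PowEncl.check_spec hκ
  obtain ⟨hμσhi, hμσr₁, hμσr₂, hμσ₁, hμσ₂⟩ := PowEncl.check_spec hμσ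
  obtain ⟨hμεhi, hμεr₁, hμεr₂, hμε₁, hμε₂⟩ := PowEncl.check_spec hμε
  rw [List.all_eq_true] at hEcells hOcells
  have hQ : ∀ p ∈ T.box, 1 / 2 < p.1 ∧ p.1 < 1 ∧ p.1 + 1 / 2 < p.2 := by
    intro p hp
    obtain ⟨⟨h1, h2⟩, ⟨h3, _⟩⟩ := hp
    have e1 : ((1 / 2 : ℚ) : ℝ) < (T.σlo : ℝ) := by exact_mod_cast hσlo
    have e2 : (T.σhi : ℝ) < ((1 : ℚ) : ℝ) := by exact_mod_cast hσhi
    have e3 : ((T.σhi + 1 / 2 : ℚ) : ℝ) < (T.εlo : ℝ) := by exact_mod_cast hgap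
    push_cast at e1 e2 e3
    exact ⟨by linarith, by linarith, by linarith⟩
  have hE₀' : (1 / 2 : ℝ) < ((T.E₀ : ℚ) : ℝ) := by
    have h : ((1 / 2 : ℚ) : ℝ) < ((T.E₀ : ℚ) : ℝ) := by exact_mod_cast hE₀
    push_cast at h
    exact h
  refine boxExcluded_of_taylorConeObligations_half T.L.toFinset (fun k ab => (T.c k ab : ℝ)) T.Lψ.toFinset
    (fun ab => (T.ψ ab : ℝ)) (κ₀ := (T.κ₀ : ℝ)) (by exact_mod_cast hκ₀) (E₀ := ((T.E₀ : ℚ) : ℝ))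
    (E_T := ((T.E_T : ℚ) : ℝ)) hE₀' hQ ?_
  refine TaylorConeObligations.of_oddCover ?hI ?hEc ?hEr
    (T.oddCells.map fun C => ⟨C.ℓ, C.lo, C.hi, C.F.toFinset⟩) ?hOcov ?hOhead ?hOF hC
  -- (I) identity
  · exact identity_pos_of_kdCheck T.c hL hκhi hκr₁ hκr₂ hκ₁ hκ₂ htI hbI
  -- (E) even cells from the cover
  · refine evenCellField_of_cover _ T.box _ (T.evenCells.map fun C => ⟨C.ℓ, C.lo, C.hi, C.F.toFinset⟩)
      ?_ ?_ ?_ hR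
    · -- cover
      rw [checkEvenCover, Bool.and_eq_true, Bool.and_eq_true, List.any_eq_true, List.all_eq_true] at hEcov
      obtain ⟨⟨⟨Cε, hCε, hCε'⟩, h3⟩, hℓ⟩ := hEcov
      rw [Bool.and_eq_true, Bool.and_eq_true, decide_eq_true_iff, decide_eq_true_iff, decide_eq_true_iff] at hCε'
      obtain ⟨⟨hCε0, hCεlo⟩, hCεhi⟩ := hCε'
      refine evenCover_of_perSpin T.box _ _ T.LE (by exact_mod_cast hLE) ?_ ?_ ?_
      · intro p hp
        refine ⟨⟨Cε.ℓ, Cε.lo, Cε.hi, Cε.F.toFinset⟩, List.mem_map.mpr ⟨Cε, hCε, rfl⟩, hCε0, ?_, ?_⟩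
        · exact le_trans (by exact_mod_cast hCεlo : ((Cε.lo : ℚ) : ℝ) ≤ (T.εlo : ℝ)) hp.2.1
        · exact le_trans hp.2.2 (by exact_mod_cast hCεhi : (T.εhi : ℝ) ≤ ((Cε.hi : ℚ) : ℝ))
      · intro Δ h3Δ hΔE
        obtain ⟨I, hI, h1, h2⟩ := chainCovers_sound _ _ _ h3 Δ (by exact_mod_cast h3Δ) hΔE.le
        obtain ⟨C, hC, hCℓ, rfl⟩ := T.exists_evenCell_of_mem_ivls hI
        exact ⟨⟨C.ℓ, C.lo, C.hi, C.F.toFinset⟩, List.mem_map.mpr ⟨C, hC, rfl⟩, hCℓ, h1, h2⟩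
      · intro ℓ hev h1ℓ hℓL Δ hbΔ hΔE
        have hch : chainCovers ((ℓ : ℚ) + 1) T.E₀ (T.evenIvls ℓ) = true := by
          have h := hℓ ℓ (List.mem_range.mpr hℓL)
          rw [Bool.or_eq_true, Bool.or_eq_true, decide_eq_true_iff, Bool.not_eq_true', decide_eq_false_iff_not] at h
          rcases h with (h | h) | h
          · omega
          · exact absurd hev h
          · exact h
        obtain ⟨I, hI, h1, h2⟩ := chainCovers_sound _ _ _ hch Δ (by push_cast; exact hbΔ) hΔE.le
        obtain ⟨C, hC, hCℓ, rfl⟩ := T.exists_evenCell_of_mem_ivls hI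
        exact ⟨⟨C.ℓ, C.lo, C.hi, C.F.toFinset⟩, List.mem_map.mpr ⟨C, hC, rfl⟩, hCℓ, h1, h2⟩
    · -- heads
      intro c hc p hp Δ ha hb _ _ _ a b
      obtain ⟨C, hC, rfl⟩ := List.mem_map.mp hc
      have hcell := hEcells C hC
      simp only [checkEvenCell, Bool.and_eq_true, decide_eq_true_eq, List.all_eq_true] at hcell
      obtain ⟨⟨⟨⟨⟨⟨⟨hFnd, hFj⟩, hℓlo⟩, hAlen⟩, _⟩, hX⟩, hY⟩, hD⟩ := hcell
      exact evenHead_nonneg_of_kdCheck T.c hL C.ℓ hFnd (fun q hq => hFj q hq) hℓlo hAlen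
        (hEnc.1 C hC) hX hY hD p hp Δ ha hb a b
    · -- off the head set
      intro c hc q hq hr
      obtain ⟨C, hC, rfl⟩ := List.mem_map.mp hc
      have hcell := hEcells C hC
      simp only [checkEvenCell, Bool.and_eq_true, decide_eq_true_eq, List.all_eq_true] at hcell
      obtain ⟨⟨⟨⟨⟨⟨⟨_, _⟩, _⟩, _⟩, hcanon⟩, _⟩, _⟩, _⟩ := hcell
      exact offHead_of_canonOK hcanon q hq hr
  -- (E5) even region
  · exact hR
  -- odd cover
  · rw [checkOddCover, Bool.and_eq_true, Bool.and_eq_true, List.any_eq_true, List.all_eq_true] at hOcov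
    obtain ⟨⟨⟨Cσ, hCσ, hCσ'⟩, h3⟩, hℓ⟩ := hOcov
    rw [Bool.and_eq_true, Bool.and_eq_true, decide_eq_true_iff, decide_eq_true_iff, decide_eq_true_iff] at hCσ'
    obtain ⟨⟨hCσ0, hCσlo⟩, hCσhi⟩ := hCσ'
    refine oddCover_of_perSpin T.box _ _ T.LT (by exact_mod_cast hLT) ?_ ?_ ?_
    · intro p hp
      refine ⟨⟨Cσ.ℓ, Cσ.lo, Cσ.hi, Cσ.F.toFinset⟩, List.mem_map.mpr ⟨Cσ, hCσ, rfl⟩, hCσ0, ?_, ?_⟩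
      · exact le_trans (by exact_mod_cast hCσlo : ((Cσ.lo : ℚ) : ℝ) ≤ (T.σlo : ℝ)) hp.1.1
      · exact le_trans hp.1.2 (by exact_mod_cast hCσhi : (T.σhi : ℝ) ≤ ((Cσ.hi : ℚ) : ℝ))
    · intro Δ h3Δ hΔE
      obtain ⟨I, hI, h1, h2⟩ := chainCovers_sound _ _ _ h3 Δ (by exact_mod_cast h3Δ) hΔE.le
      obtain ⟨C, hC, hCℓ, rfl⟩ := T.exists_oddCell_of_mem_ivls hI
      exact ⟨⟨C.ℓ, C.lo, C.hi, C.F.toFinset⟩, List.mem_map.mpr ⟨C, hC, rfl⟩, hCℓ, h1, h2⟩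
    · intro ℓ h1ℓ hℓL Δ hbΔ hΔE
      have hch : chainCovers ((ℓ : ℚ) + 1) T.E_T (T.oddIvls ℓ) = true := by
        have h := hℓ ℓ (List.mem_range.mpr hℓL)
        rw [Bool.or_eq_true, decide_eq_true_iff] at h
        rcases h with h | h
        · omega
        · exact h
      obtain ⟨I, hI, h1, h2⟩ := chainCovers_sound _ _ _ hch Δ (by push_cast; exact hbΔ.le) hΔE.le
      obtain ⟨C, hC, hCℓ, rfl⟩ := T.exists_oddCell_of_mem_ivls hI
      exact ⟨⟨C.ℓ, C.lo, C.hi, C.F.toFinset⟩, List.mem_map.mpr ⟨C, hC, rfl⟩, hCℓ, h1, h2⟩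
  -- odd heads (regularised: uses the strict hypothesis `b_ℓ < Δ`)
  · intro c hc p hp Δ ha hb hbΔ _ _
    obtain ⟨C, hC, rfl⟩ := List.mem_map.mp hc
    have hcell := hOcells C hC
    simp only [checkOddCell, Bool.and_eq_true, decide_eq_true_eq, List.all_eq_true] at hcell
    obtain ⟨⟨⟨⟨⟨hFnd, hFj⟩, hℓlo⟩, hAlen⟩, _⟩, ht⟩ := hcell
    exact oddHead_nonneg_of_kdCheck_reg' T.c hL T.ψ hLψ T.κ₀ C.ℓ hFnd (fun q hq => hFj q hq) hℓlo
      hκhi hκr₁ hκr₂ hκ₁ hκ₂ hμσhi hμσr₁ hμσr₂ hμσ₁ hμσ₂ hμεhi hμεr₁ hμεr₂ hμε₁ hμε₂ hAlen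
      (hEnc.2 C hC) ht p hp Δ ha hb hbΔ
  -- off the odd head sets
  · intro c hc q hq hr
    obtain ⟨C, hC, rfl⟩ := List.mem_map.mp hc
    have hcell := hOcells C hC
    simp only [checkOddCell, Bool.and_eq_true, decide_eq_true_eq, List.all_eq_true] at hcell
    obtain ⟨⟨⟨⟨⟨_, _⟩, _⟩, _⟩, hcanon⟩, _⟩ := hcell
    exact offHead_of_canonOK hcanon q hq hr

end TaylorTable

/-! ### The decidable odd enclosure check -/

/-- Per-entry odd check: the regularised table interval of family `(a,b) ∈ [a₁,a₂] × [b₁,b₂]` on the cell, divided by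
`λ_ℓ`, sits inside the claimed interval `I`. [folklore] -/
def oddEnclFamilyOK (a₁ a₂ b₁ b₂ lo hi : ℚ) (ℓ : ℕ) (q : ℕ × ℕ) (I : ℚ × ℚ) : Bool :=
  let B : ABBox := ⟨a₁, a₂, b₁, b₂, lo, hi⟩
  B.ok ℓ q.1 && decide (I.1 ≤ (regABI B ℓ q.1 q.2).fst / legendreLamQ ℓ) &&
    decide ((regABI B ℓ q.1 q.2).snd / legendreLamQ ℓ ≤ I.2)

/-- **Soundness of `oddEnclFamilyOK`.** [cite: DolanOsborn2004, §3 eq. (3.12)] -/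
theorem oddEnclFamilyOK_sound {a₁ a₂ b₁ b₂ lo hi : ℚ} {ℓ : ℕ} {q : ℕ × ℕ} {I : ℚ × ℚ}
    (hc : oddEnclFamilyOK a₁ a₂ b₁ b₂ lo hi ℓ q I = true) {a b Δ : ℝ}
    (ha : (a₁ : ℝ) ≤ a ∧ a ≤ a₂) (hb : (b₁ : ℝ) ≤ b ∧ b ≤ b₂) (hΔ : (lo : ℝ) ≤ Δ ∧ Δ ≤ hi)
    (hbΔ : unitarityBound3D ℓ < Δ) :
    (I.1 : ℝ) ≤ (Δ - unitarityBound3D ℓ) * (hrCoeffAB a b Δ ℓ q.1 q.2 / legendreLam ℓ) ∧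
      (Δ - unitarityBound3D ℓ) * (hrCoeffAB a b Δ ℓ q.1 q.2 / legendreLam ℓ) ≤ (I.2 : ℝ) := by
  have hlam : 0 < legendreLam ℓ := legendreLam_pos ℓ
  simp only [oddEnclFamilyOK, Bool.and_eq_true, decide_eq_true_eq] at hc
  obtain ⟨⟨hok, hL⟩, hU⟩ := hc
  have hm := regAB_mem hok (a := a) (b := b) (Δ := Δ) ⟨ha, hb, hΔ⟩ hbΔ q.1 le_rfl q.2
  rw [mem_ratCast_iff] at hm
  have hL' : ((I.1 : ℚ) : ℝ) ≤ (((regABI ⟨a₁, a₂, b₁, b₂, lo, hi⟩ ℓ q.1 q.2).fst / legendreLamQ ℓ : ℚ) : ℝ) := by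
    exact_mod_cast hL
  have hU' : (((regABI ⟨a₁, a₂, b₁, b₂, lo, hi⟩ ℓ q.1 q.2).snd / legendreLamQ ℓ : ℚ) : ℝ) ≤ ((I.2 : ℚ) : ℝ) := by
    exact_mod_cast hU
  rw [Rat.cast_div, cast_legendreLamQ] at hL' hU'
  rw [← mul_div_assoc]
  exact ⟨hL'.trans (div_le_div_of_nonneg_right hm.1 hlam.le), (div_le_div_of_nonneg_right hm.2 hlam.le).trans hU'⟩

namespace TaylorTable

variable (T : TaylorTable)

/-- Per odd cell: every head term's three claimed intervals pass the family checks with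
`t = Δσ - Δε ∈ [σlo - εhi, σhi - εlo]`: `cₛ`: `(a,b) = (-t/2, t/2)`, `c₊`: `(t/2, t/2)`, `c₋`: `(-t/2, -t/2)`. [folklore] -/
def oddEnclOK (C : OddCellData) : Bool :=
  let t₁ := T.σlo - T.εhi
  let t₂ := T.σhi - T.εlo
  decide (C.A.length = C.F.length) &&
    (List.zip C.F C.A).all fun p =>
      oddEnclFamilyOK (-t₂ / 2) (-t₁ / 2) (t₁ / 2) (t₂ / 2) C.lo C.hi C.ℓ p.1 p.2.1 &&
      oddEnclFamilyOK (t₁ / 2) (t₂ / 2) (t₁ / 2) (t₂ / 2) C.lo C.hi C.ℓ p.1 p.2.2.1 &&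
      oddEnclFamilyOK (-t₂ / 2) (-t₁ / 2) (-t₂ / 2) (-t₁ / 2) C.lo C.hi C.ℓ p.1 p.2.2.2

/-- **The decidable coefficient-enclosure check of a table** (even and odd cells). [folklore] -/
def checkEncl : Bool := T.evenCells.all evenEnclOK && T.oddCells.all T.oddEnclOK

/-- **Soundness of `checkEncl`.** [cite: KosPolandSimmonsduffin2014, §3.3 eq. (3.16)] -/
theorem enclosuresStrict_of_checkEncl (h : T.checkEncl = true) : T.EnclosuresStrict := by
  rw [checkEncl, Bool.and_eq_true] at h
  obtain ⟨he, ho⟩ := h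
  refine ⟨T.evenEnclosures_of_check he, ?_⟩
  rw [List.all_eq_true] at ho
  intro C hC p hp Δ hlo hhi hbΔ i q I hq hI
  have hc := ho C hC
  simp only [oddEnclOK, Bool.and_eq_true, decide_eq_true_eq, List.all_eq_true] at hc
  obtain ⟨_, hall⟩ := hc
  have hmem : (q, I) ∈ List.zip C.F C.A :=
    List.mem_iff_getElem?.mpr ⟨i, by rw [List.getElem?_zip_eq_some]; exact ⟨hq, hI⟩⟩
  obtain ⟨⟨hS, hP⟩, hM⟩ := hall _ hmem
  obtain ⟨⟨hσ1, hσ2⟩, ⟨hε1, hε2⟩⟩ := hp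
  -- t = Δσ - Δε ∈ [σlo - εhi, σhi - εlo]
  have ht1 : ((T.σlo - T.εhi : ℚ) : ℝ) ≤ p.1 - p.2 := by push_cast; linarith
  have ht2 : p.1 - p.2 ≤ ((T.σhi - T.εlo : ℚ) : ℝ) := by push_cast; linarith
  have haS : (((-(T.σhi - T.εlo) / 2 : ℚ)) : ℝ) ≤ -(p.1 - p.2) / 2 ∧ -(p.1 - p.2) / 2 ≤ ((-(T.σlo - T.εhi) / 2 : ℚ) : ℝ) := by
    constructor <;> push_cast at ht1 ht2 ⊢ <;> linarith
  have hbS : (((T.σlo - T.εhi) / 2 : ℚ) : ℝ) ≤ (p.1 - p.2) / 2 ∧ (p.1 - p.2) / 2 ≤ (((T.σhi - T.εlo) / 2 : ℚ) : ℝ) := by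
    constructor <;> push_cast at ht1 ht2 ⊢ <;> linarith
  refine ⟨?_, ?_, ?_⟩
  · simpa [oddCoeffsReg, oddCoeffs] using oddEnclFamilyOK_sound hS haS hbS ⟨hlo, hhi⟩ hbΔ
  · simpa [oddCoeffsReg, oddCoeffs] using oddEnclFamilyOK_sound hP hbS hbS ⟨hlo, hhi⟩ hbΔ
  · simpa [oddCoeffsReg, oddCoeffs] using oddEnclFamilyOK_sound hM haS haS ⟨hlo, hhi⟩ hbΔ

/-- **THE TABLE THEOREM (g2) with every coefficient enclosure decided by the kernel**: only the two REGION layers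
remain as hypotheses. [cite: KosPolandSimmonsduffin2014, §3.3 eq. (3.16)] -/
theorem boxExcluded_of_taylorTable_dec (h : T.check = true) (he : T.checkEncl = true)
    (hR : TaylorEvenRegion T.α T.box ((T.E₀ : ℚ) : ℝ)) (hC : T.OddCone) : BoxExcluded T.box :=
  T.boxExcluded_of_taylorTable_strict h (T.enclosuresStrict_of_checkEncl he) hR hC

end TaylorTable

end Summit.CriticalPhenomena.Ising3D
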